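import Summits.AtomisticToContinuum.FouriersLaw.Theorems.BondHeatUncertaintyExtensiveSnapshotIrreversibilityTapDualityOddCorrectorAux1
import Summits.AtomisticToContinuum.FouriersLaw.Theorems.HonestZwanzigOrthogonalOhmDirichletBound

/-!
# Stub `stub_pencilOfGreenKubo` of line `cayley-pencil` (crux `ContactStieltjesMeasure.StieltjesRepresentation`,
# stmt-AtomisticToContinuum-15248), part 3: smooth Poisson solutions at `0 ≤ lam`, their Dirichlet identity and pairing

Helper file (`--supports stmt-AtomisticToContinuum-15248`). Pinned anharmonic chain `P = pinnedChain ω₂ lam β γ` with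
`ω₂, β, γ > 0` and `lam ≥ 0` (skeleton v3 of the line widened its open-range stubs to `0 ≤ lam`), `N ≥ 1`, both baths at
`T > 0`, equilibrium kernels `P_t = P.transitionKernel N T T t`, Gibbs weight `ρ = e^{-H/T}`, generator `L = L_{T,T}`.

* `poisson_smooth_of_decay_nn`, `pairing_fubini_nn` — the tree's `TapDuality.poisson_smooth_of_decay` and
  `TapDuality.pairing_fubini` (…TapDualityOddCorrectorAux1, stated there under a section hypothesis `0 < lam` that their
  proofs only use through `hl.le`) RE-ELABORATED VERBATIM at `0 ≤ lam` (adapted from that file; every input —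
  `integral_transpose_mul_forwardIntegral`, `exists_smooth_ae_eq_of_weak_poisson`, `generator_eq_of_weak_poisson`,
  `stronglyMeasurable_forwardIntegral`, `stronglyMeasurable_act_uncurry`, Hörmander — already takes `0 ≤ lam`).
* `exists_poisson_solution` — for a smooth CENTRED source `v` (`∫ v ρ = 0`) with `|v| ≤ C e^{H/(8T)}` there is a smooth
  `w` with `L w = -v` pointwise, `|w| ≤ K' e^{H/(8T)}`, a.e. equal to the forward integral `∫₀^∞ P_t v dt` (Harris bound
  `pinnedChain_harris_bound` ⇒ decaying forecasts, then `poisson_smooth_of_decay_nn`).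
* `dirichlet_of_poisson` — for such a pair (`N ≥ 2`): `(∂_{p_b} w)² ρ ∈ L¹` at both bath sites and the EXACT energy
  identity `γT(∫(∂_{p_0}w)²ρ + ∫(∂_{p_{N-1}}w)²ρ) = ∫ v w ρ` (the tree's `OrthogonalOhmLine.DirichletBound.dirichlet_identity`).
References: Cuneo–Eckmann–Hairer–Rey-Bellet 2018, Thm 2.13; Hörmander 1967, Thm 1.1. No definitions.
-/

noncomputable section

open MeasureTheory ProbabilityTheory Filter Topology Set Function
open scoped NNReal ENNReal ContDiff
open Literature.MathematicalPhysics.KineticTheory.HeatConduction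
open Literature.MathematicalPhysics.KineticTheory Literature.Analysis.Distribution OscillatorChain
open Summit.AtomisticToContinuum.FouriersLaw.Theorems.SuperadditiveResistance.PlainForwardField
open Summit.AtomisticToContinuum.FouriersLaw.Theorems.SubdiffusiveBondHeat
open Summit.AtomisticToContinuum.FouriersLaw.Theorems.OddSectorIrreversibility
open Summit.AtomisticToContinuum.FouriersLaw.Theorems.OddSectorIrreversibility.Corrector
open Summit.AtomisticToContinuum.FouriersLaw.Theorems.ExtensiveSnapshotIrreversibility.TapDuality

namespace Summit.AtomisticToContinuum.FouriersLaw.Theorems.ContactStieltjesMeasure.CayleyPencil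

namespace Pencil

variable {N : ℕ}

section Pinned

variable {ω₂ lam β γ : ℝ} (hω : 0 < ω₂) (hβ : 0 < β) (hγ : 0 < γ) {T : ℝ} (hT : 0 < T) (hN : 0 < N)
include hω hβ hγ hT hN

/-! ### The tree's Poisson pipeline, re-elaborated at `0 ≤ lam` -/

-- adapted from Theorems/BondHeatUncertaintyExtensiveSnapshotIrreversibilityTapDualityOddCorrectorAux1.lean
/-- **Smooth solutions of the Poisson equation for decaying smooth sources.** For the pinned chain at
equilibrium temperature `T` (`N ≥ 1`), a smooth `k` with `|k| ≤ K e^{ϑH}` (`0 < ϑ < 1/T`) whose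
forecasts decay, `|P_t k(z)| ≤ M e^{ϑH(z)} e^{-ct}` (`c > 0`): there is a smooth `v` with
`∫_{(0,∞)} P_t k dt = v` Lebesgue-a.e., `L_{T,T} v = -k` pointwise, and `|v| ≤ K' e^{ϑH}` for some
`K' ≥ 0` (the proof of `Corrector.corrector_smooth` for a general source).
[cite: CuneoEckmannHairerReyBellet2018, Thm 2.13] [cite: Hormander1967, Thm 1.1] -/
theorem poisson_smooth_of_decay_nn (hl : 0 ≤ lam) {ϑ K M c : ℝ} (hϑ : 0 < ϑ) (hϑT : ϑ < 1 / T) (hc : 0 < c)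
    {k : PhaseSpace N → ℝ} (hk : ContDiff ℝ ∞ k)
    (hkb : ∀ y, |k y| ≤ K * Real.exp (ϑ * (pinnedChain ω₂ lam β γ).hamiltonian N y))
    (hdecay : ∀ (t : ℝ≥0) (z : PhaseSpace N),
      |∫ y, k y ∂((pinnedChain ω₂ lam β γ).transitionKernel N T T t z)| ≤
        M * Real.exp (ϑ * (pinnedChain ω₂ lam β γ).hamiltonian N z) * Real.exp (-c * t)) :
    ∃ v : PhaseSpace N → ℝ, ContDiff ℝ ∞ v ∧
      (fun x => ∫ t in Ioi (0 : ℝ), ∫ y, k y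
        ∂((pinnedChain ω₂ lam β γ).transitionKernel N T T t.toNNReal x)) =ᵐ[volume] v ∧
      (∀ x, (pinnedChain ω₂ lam β γ).generator N T T v x = -k x) ∧
      ∃ K' : ℝ, 0 ≤ K' ∧
        ∀ x, |v x| ≤ K' * Real.exp (ϑ * (pinnedChain ω₂ lam β γ).hamiltonian N x) := by
  haveI := isAddHaarMeasure_volume_phaseSpace N
  set P := pinnedChain ω₂ lam β γ with hP
  have hU : ContDiff ℝ ∞ P.U := pinnedChain_contDiff_U ω₂ lam β γ
  have hV : ContDiff ℝ ∞ P.V := pinnedChain_contDiff_V ω₂ lam β γ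
  have hγ' : P.γ = γ := rfl
  have hγT : 0 ≤ P.γ * T := by rw [hγ']; positivity
  have hkc : Continuous k := hk.continuous
  set Hm := P.hamiltonian N with hHm
  have hHc : Continuous Hm := pinnedChain_continuous_hamiltonian ω₂ lam β γ N
  -- kernels: the chain pipeline's `transitionKernel` is the model-free `langevinKernel`
  have hker : ∀ t, P.langevinKernel N T T t = P.transitionKernel N T T t :=
    fun t => pinnedChain_langevinKernel_eq_transitionKernel N T T hω hl hβ.le hγ.le t
  have hdecay' : ∀ (t : ℝ≥0) (z : PhaseSpace N), |∫ y, k y ∂(P.langevinKernel N T T t z)| ≤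
      M * Real.exp (ϑ * Hm z) * Real.exp (-c * t) := fun t z => by
    rw [hker]; exact hdecay t z
  have hM : 0 ≤ M := by
    have h0 : 0 ≤ M * Real.exp (ϑ * Hm 0) * Real.exp (-c * ((0 : ℝ≥0) : ℝ)) :=
      (abs_nonneg _).trans (hdecay 0 0)
    have h1 : 0 ≤ M * Real.exp (ϑ * Hm 0) := nonneg_of_mul_nonneg_left h0 (Real.exp_pos _)
    exact nonneg_of_mul_nonneg_left h1 (Real.exp_pos _)
  -- the candidate and its a-priori bound
  set g₀ : PhaseSpace N → ℝ := fun x => ∫ t in Ioi (0 : ℝ),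
    ∫ y, k y ∂(P.langevinKernel N T T t.toNNReal x) with hg₀
  have hg₀m : StronglyMeasurable g₀ := stronglyMeasurable_forwardIntegral hω hl hβ.le hγ.le hkc
  have hIpos : 0 ≤ ∫ t in Ioi (0 : ℝ), Real.exp (-c * t) :=
    setIntegral_nonneg measurableSet_Ioi fun t _ => (Real.exp_pos _).le
  set K' : ℝ := M * ∫ t in Ioi (0 : ℝ), Real.exp (-c * t) with hK'
  have hK'0 : 0 ≤ K' := mul_nonneg hM hIpos
  have hg₀b : ∀ x, |g₀ x| ≤ K' * Real.exp (ϑ * Hm x) := fun x =>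
    abs_forwardIntegral_le k hc hdecay' x
  set B : PhaseSpace N → ℝ := fun x => K' * Real.exp (ϑ * Hm x) with hB
  have hBc : Continuous B := by rw [hB]; fun_prop
  have hg₀B : ∀ x, ‖g₀ x‖ ≤ ‖B x‖ := fun x => by
    rw [Real.norm_eq_abs, Real.norm_eq_abs]
    exact (hg₀b x).trans (le_abs_self _)
  have hg₀loc : LocallyIntegrable g₀ volume :=
    hBc.locallyIntegrable.mono hg₀m.aestronglyMeasurable (Eventually.of_forall hg₀B)
  -- the Poisson equation in `𝓓'`
  have hweak₀ : ∀ φ : PhaseSpace N → ℝ, ContDiff ℝ ∞ φ → HasCompactSupport φ →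
      ∫ x, g₀ x * hormanderTranspose (P.drift N) (P.bathField hN T T) (fun _ => 0) φ x =
        ∫ x, (-k x) * φ x := by
    intro φ hφ hφc
    have h := integral_transpose_mul_forwardIntegral hω hl hβ.le hγ.le hN hT hϑ hϑT hc hk hkb
      hdecay' hφ hφc
    calc ∫ x, g₀ x * hormanderTranspose (P.drift N) (P.bathField hN T T) (fun _ => 0) φ x
        = ∫ x, (sdeGenerator (fun y => -P.drift N y) (P.bathVecL N T) (P.bathVecR N T) φ x +
            2 * γ * φ x) * g₀ x := by
          refine integral_congr_ae (ae_of_all _ fun x => ?_)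
          dsimp only
          rw [hormanderTranspose_generatorFamily_eq_revGenerator P hU hV hN hγT hγT hφ x, hγ', mul_comm]
      _ = -∫ x, φ x * k x := h
      _ = ∫ x, (-k x) * φ x := by
          rw [← integral_neg]
          exact integral_congr_ae (ae_of_all _ fun x => by ring)
  -- hypoelliptic regularity and the classical equation
  obtain ⟨v, hv, hae⟩ := exists_smooth_ae_eq_of_weak_poisson hβ.le hγ hN hT hg₀loc hk.neg hweak₀
  have hweak : ∀ φ : PhaseSpace N → ℝ, ContDiff ℝ ∞ φ → HasCompactSupport φ →
      ∫ x, v x * hormanderTranspose (P.drift N) (P.bathField hN T T) (fun _ => 0) φ x =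
        ∫ x, (-k x) * φ x := by
    intro φ hφ hφc
    rw [← hweak₀ φ hφ hφc]
    refine integral_congr_ae ?_
    filter_upwards [hae] with x hx
    rw [hx]
  have hclass : ∀ x, P.generator N T T v x = -k x :=
    generator_eq_of_weak_poisson P hU hV hN hγT hγT hv hkc.neg hweak
  have hg₀' : (fun x => ∫ t in Ioi (0 : ℝ), ∫ y, k y ∂(P.transitionKernel N T T t.toNNReal x)) = g₀ := by
    funext x; simp only [hg₀, hker]
  refine ⟨v, hv, by rw [hg₀']; exact hae, hclass, K', hK'0, fun x => ?_⟩
  have hael : ∀ᵐ y ∂(volume : Measure (PhaseSpace N)), |v y| ≤ K' * Real.exp (ϑ * Hm y) := by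
    filter_upwards [hae] with y hy
    rw [← hy]; exact hg₀b y
  exact le_of_ae_le_of_continuous (continuous_abs.comp hv.continuous) (by fun_prop) hael x

omit hγ hN in
/-- **Fubini for forecast pairings.** For continuous `f` with `|f| ≤ A e^{ϑH}`, a continuous `g` with
decaying forecasts `|P_t g(z)| ≤ M e^{ϑH(z)} e^{-ct}` (`c > 0`, `2ϑ < 1/T`), and `ρ = e^{-H/T}`:
`t ↦ ∫ f · P_t g ρ dx` is integrable on `(0, ∞)` and
`∫_{(0,∞)} ∫ f · P_t g ρ dx dt = ∫ f · (∫_{(0,∞)} P_t g dt) ρ dx` (domination by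
`A M e^{2ϑH} ρ e^{-ct} ∈ L¹`; joint measurability of the forecasts). [folklore] -/
theorem pairing_fubini_nn (hl : 0 ≤ lam) (hγ : 0 ≤ γ) {ϑ A M c : ℝ} (h2ϑ : 2 * ϑ < 1 / T) (hc : 0 < c)
    {f g : PhaseSpace N → ℝ} (hf : Continuous f) (hg : Continuous g)
    (hfb : ∀ y, |f y| ≤ A * Real.exp (ϑ * (pinnedChain ω₂ lam β γ).hamiltonian N y))
    (hdecay : ∀ (t : ℝ≥0) (z : PhaseSpace N),
      |∫ y, g y ∂((pinnedChain ω₂ lam β γ).transitionKernel N T T t z)| ≤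
        M * Real.exp (ϑ * (pinnedChain ω₂ lam β γ).hamiltonian N z) * Real.exp (-c * t)) :
    IntegrableOn (fun t : ℝ => ∫ z, f z *
        (∫ y, g y ∂((pinnedChain ω₂ lam β γ).transitionKernel N T T t.toNNReal z)) *
          (pinnedChain ω₂ lam β γ).gibbsDensity N T z) (Ioi 0) ∧
    ∫ t in Ioi (0 : ℝ), ∫ z, f z *
        (∫ y, g y ∂((pinnedChain ω₂ lam β γ).transitionKernel N T T t.toNNReal z)) *
          (pinnedChain ω₂ lam β γ).gibbsDensity N T z =
      ∫ z, f z * (∫ t in Ioi (0 : ℝ),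
        ∫ y, g y ∂((pinnedChain ω₂ lam β γ).transitionKernel N T T t.toNNReal z)) *
          (pinnedChain ω₂ lam β γ).gibbsDensity N T z := by
  set P := pinnedChain ω₂ lam β γ with hP
  set Hm := P.hamiltonian N with hHm
  set ρ := P.gibbsDensity N T with hρ
  have hHc : Continuous Hm := pinnedChain_continuous_hamiltonian ω₂ lam β γ N
  have hρc : Continuous ρ := pinnedChain_continuous_gibbsDensity ω₂ lam β γ N T
  have hρ0 : ∀ x, 0 < ρ x := fun x => P.gibbsDensity_pos N T x
  have hker : ∀ t, P.langevinKernel N T T t = P.transitionKernel N T T t :=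
    fun t => pinnedChain_langevinKernel_eq_transitionKernel N T T hω hl hβ.le hγ t
  have hM : 0 ≤ M := by
    have h0 : 0 ≤ M * Real.exp (ϑ * Hm 0) * Real.exp (-c * ((0 : ℝ≥0) : ℝ)) :=
      (abs_nonneg _).trans (hdecay 0 0)
    have h1 : 0 ≤ M * Real.exp (ϑ * Hm 0) := nonneg_of_mul_nonneg_left h0 (Real.exp_pos _)
    exact nonneg_of_mul_nonneg_left h1 (Real.exp_pos _)
  -- the forecasts `U t z = P_{t⁺} g (z)`: joint measurability and decay
  set U : ℝ → PhaseSpace N → ℝ := fun t z => ∫ y, g y ∂(P.transitionKernel N T T t.toNNReal z) with hU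
  have hUm : StronglyMeasurable (Function.uncurry U) := by
    have h : StronglyMeasurable fun q : ℝ × PhaseSpace N =>
        ∫ y, g y ∂(P.langevinKernel N T T q.1.toNNReal q.2) :=
      stronglyMeasurable_act_uncurry hω hl hβ.le hγ (T := T) hg
    simp only [hker] at h
    exact h
  have hUb : ∀ t z, |U t z| ≤ M * Real.exp (ϑ * Hm z) * Real.exp (-c * t) := by
    intro t z
    have h := hdecay t.toNNReal z
    refine h.trans (mul_le_mul_of_nonneg_left (Real.exp_le_exp.2 ?_) (mul_nonneg hM (Real.exp_pos _).le))
    have : t ≤ (t.toNNReal : ℝ) := Real.le_coe_toNNReal t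
    nlinarith
  -- the integrand on `(0,∞) × Ω` and its majorant
  set F : ℝ → PhaseSpace N → ℝ := fun t z => f z * U t z * ρ z with hF
  have hFm : StronglyMeasurable (Function.uncurry F) := by
    have h1 : StronglyMeasurable fun q : ℝ × PhaseSpace N => f q.2 :=
      (hf.comp continuous_snd).stronglyMeasurable
    have h3 : StronglyMeasurable fun q : ℝ × PhaseSpace N => ρ q.2 :=
      (hρc.comp continuous_snd).stronglyMeasurable
    exact (h1.mul hUm).mul h3
  have h2int : Integrable (fun z => Real.exp (2 * ϑ * Hm z) * ρ z) :=
    pinnedChain_integrable_exp_mul_gibbsDensity hω hl hβ.le γ N hT h2ϑ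
  have hGint : Integrable (fun z => |f z| * (M * Real.exp (ϑ * Hm z)) * ρ z) := by
    refine (h2int.const_mul (A * M)).mono' ?_ (Eventually.of_forall fun z => ?_)
    · exact (((continuous_abs.comp hf).mul (continuous_const.mul (by fun_prop))).mul
        hρc).aestronglyMeasurable
    · have hez := (Real.exp_pos (ϑ * Hm z)).le
      have hρz := (hρ0 z).le
      have hnn : 0 ≤ |f z| * (M * Real.exp (ϑ * Hm z)) * ρ z :=
        mul_nonneg (mul_nonneg (abs_nonneg _) (mul_nonneg hM hez)) hρz
      have e2 : Real.exp (2 * ϑ * Hm z) = Real.exp (ϑ * Hm z) * Real.exp (ϑ * Hm z) := by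
        rw [← Real.exp_add]; ring_nf
      rw [Real.norm_of_nonneg hnn, e2]
      calc |f z| * (M * Real.exp (ϑ * Hm z)) * ρ z
          ≤ (A * Real.exp (ϑ * Hm z)) * (M * Real.exp (ϑ * Hm z)) * ρ z :=
            mul_le_mul_of_nonneg_right (mul_le_mul_of_nonneg_right (hfb z) (mul_nonneg hM hez)) hρz
        _ = A * M * (Real.exp (ϑ * Hm z) * Real.exp (ϑ * Hm z) * ρ z) := by ring
  have hprod : Integrable (Function.uncurry F) ((volume.restrict (Ioi (0 : ℝ))).prod volume) := by
    have hg' : Integrable (fun q : ℝ × PhaseSpace N => Real.exp (-c * q.1) *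
        (|f q.2| * (M * Real.exp (ϑ * Hm q.2)) * ρ q.2)) ((volume.restrict (Ioi (0 : ℝ))).prod volume) :=
      Integrable.mul_prod (exp_neg_integrableOn_Ioi 0 hc) hGint
    refine hg'.mono' hFm.aestronglyMeasurable (Eventually.of_forall fun q => ?_)
    rcases q with ⟨t, z⟩
    rw [Real.norm_eq_abs]
    show |f z * U t z * ρ z| ≤ Real.exp (-c * t) * (|f z| * (M * Real.exp (ϑ * Hm z)) * ρ z)
    rw [abs_mul, abs_mul, abs_of_nonneg (hρ0 z).le]
    have hU' := hUb t z
    have hf0 := abs_nonneg (f z)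
    have hρz := (hρ0 z).le
    calc |f z| * |U t z| * ρ z ≤ |f z| * (M * Real.exp (ϑ * Hm z) * Real.exp (-c * t)) * ρ z :=
          mul_le_mul_of_nonneg_right (mul_le_mul_of_nonneg_left hU' hf0) hρz
      _ = Real.exp (-c * t) * (|f z| * (M * Real.exp (ϑ * Hm z)) * ρ z) := by ring
  refine ⟨?_, ?_⟩
  · -- integrability of the time slices
    exact hprod.integral_prod_left
  · -- Fubini
    have hswap := integral_integral_swap hprod
    calc ∫ t in Ioi (0 : ℝ), ∫ z, F t z = ∫ z, ∫ t in Ioi (0 : ℝ), F t z := hswap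
      _ = ∫ z, f z * (∫ t in Ioi (0 : ℝ), U t z) * ρ z := by
          refine integral_congr_ae (ae_of_all _ fun z => ?_)
          show ∫ t in Ioi (0 : ℝ), f z * U t z * ρ z = f z * (∫ t in Ioi (0 : ℝ), U t z) * ρ z
          rw [integral_mul_const, integral_const_mul]

/-! ### Poisson solutions for centred nice sources at the exponent `1/(8T)` -/

omit hω hβ hγ hT hN in
/-- `C e^{H/(8T)} = C e^{ϑH}` with `ϑ = 1/(8T)` (bookkeeping between the two spellings of the tree). [folklore] -/
theorem exp_div_eight_eq (y : PhaseSpace N) :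
    Real.exp ((pinnedChain ω₂ lam β γ).hamiltonian N y / (8 * T)) =
      Real.exp (1 / (8 * T) * (pinnedChain ω₂ lam β γ).hamiltonian N y) := by
  congr 1; ring

/-- **Smooth Poisson solutions for centred nice sources.** For a smooth `v` with `|v| ≤ C e^{H/(8T)}` (`C ≥ 0`) and
`∫ v e^{-H/T} = 0` there is a smooth `w` with `L_{T,T} w = -v` pointwise, `|w| ≤ K' e^{H/(8T)}` (`K' ≥ 0`), which is
Lebesgue-a.e. the forward integral `∫₀^∞ P_t v dt` (Harris bound ⇒ `|P_t v| ≤ K₀C e^{H/(8T)} e^{-ct}`, then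
`poisson_smooth_of_decay_nn`). [cite: CuneoEckmannHairerReyBellet2018, Thm 2.13] [cite: Hormander1967, Thm 1.1] -/
theorem exists_poisson_solution (hl : 0 ≤ lam) {v : PhaseSpace N → ℝ} (hv : ContDiff ℝ ∞ v) {C : ℝ} (hC : 0 ≤ C)
    (hvb : ∀ y, |v y| ≤ C * Real.exp ((pinnedChain ω₂ lam β γ).hamiltonian N y / (8 * T)))
    (hv0 : ∫ x, v x * (pinnedChain ω₂ lam β γ).gibbsDensity N T x = 0) :
    ∃ w : PhaseSpace N → ℝ, ContDiff ℝ ∞ w ∧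
      (∀ x, (pinnedChain ω₂ lam β γ).generator N T T w x = -v x) ∧
      (∃ K' : ℝ, 0 ≤ K' ∧ ∀ x, |w x| ≤ K' * Real.exp ((pinnedChain ω₂ lam β γ).hamiltonian N x / (8 * T))) ∧
      (∃ M c : ℝ, 0 ≤ M ∧ 0 < c ∧ ∀ (t : ℝ≥0) (z : PhaseSpace N),
        |∫ y, v y ∂((pinnedChain ω₂ lam β γ).transitionKernel N T T t z)| ≤
          M * Real.exp ((pinnedChain ω₂ lam β γ).hamiltonian N z / (8 * T)) * Real.exp (-c * t)) ∧
      (fun x => ∫ t in Ioi (0 : ℝ), ∫ y, v y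
        ∂((pinnedChain ω₂ lam β γ).transitionKernel N T T t.toNNReal x)) =ᵐ[volume] w := by
  set P := pinnedChain ω₂ lam β γ with hP
  have hϑ : 0 < 1 / (8 * T) := by positivity
  have hϑT : 1 / (8 * T) < 1 / T := by
    rw [div_lt_div_iff_of_pos_left one_pos (by positivity) hT]; linarith
  have hvb' : ∀ y, |v y| ≤ C * Real.exp (1 / (8 * T) * P.hamiltonian N y) := fun y => by
    rw [← exp_div_eight_eq (ω₂ := ω₂) (lam := lam) (β := β) (γ := γ) (T := T) y]; exact hvb y
  -- the source is centred under `μ_T`, so its forecasts decay (Harris)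
  have hμ0 : ∫ y, v y ∂(P.gibbsMeasure N T) = 0 := by
    rw [P.integral_gibbsMeasure, hv0, mul_zero]
  obtain ⟨K₀, c, hK₀, hc, hb⟩ := pinnedChain_harris_bound hω hl hβ hγ hN hT hϑ hϑT
  have hdecay : ∀ (t : ℝ≥0) (z : PhaseSpace N), |∫ y, v y ∂(P.transitionKernel N T T t z)| ≤
      K₀ * C * Real.exp (1 / (8 * T) * P.hamiltonian N z) * Real.exp (-c * t) := by
    intro t z
    have h := hb z t v hv.continuous C hC hvb'
    rwa [hμ0, sub_zero] at h
  obtain ⟨w, hw, hae, hLw, K', hK'0, hwb⟩ :=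
    poisson_smooth_of_decay_nn hω hβ hγ hT hN hl hϑ hϑT hc hv hvb' hdecay
  refine ⟨w, hw, hLw, ⟨K', hK'0, fun x => ?_⟩, ⟨K₀ * C, c, by positivity, hc, fun t z => ?_⟩, hae⟩
  · rw [exp_div_eight_eq (ω₂ := ω₂) (lam := lam) (β := β) (γ := γ) (T := T) x]; exact hwb x
  · rw [exp_div_eight_eq (ω₂ := ω₂) (lam := lam) (β := β) (γ := γ) (T := T) z]; exact hdecay t z

omit hγ in
/-- **The exact energy (Dirichlet) identity of a Poisson pair** (`N ≥ 2`). For `w ∈ C^∞` with `L_{T,T} w = -v`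
pointwise, `v` continuous, `|v| ≤ C e^{H/(8T)}`, `|w| ≤ K e^{H/(8T)}` and `γ > 0`: `(∂_{p_0}w)² ρ, (∂_{p_{N-1}}w)² ρ ∈ L¹`
and `γT(∫(∂_{p_0}w)²ρ + ∫(∂_{p_{N-1}}w)²ρ) = ∫ v w ρ` — ALL entropy is produced at the two contacts.
(The tree's `OrthogonalOhmLine.DirichletBound.dirichlet_identity`, fed by `integrable_weights`.)
[cite: CuneoEckmannHairerReyBellet2018, §3.1] -/
theorem dirichlet_of_poisson (hl : 0 ≤ lam) (hN2 : 2 ≤ N) (hγ' : 0 < γ) {v w : PhaseSpace N → ℝ} (hvc : Continuous v)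
    (hw : ContDiff ℝ ∞ w) (hLw : ∀ x, (pinnedChain ω₂ lam β γ).generator N T T w x = -v x) {C K : ℝ}
    (hvb : ∀ y, |v y| ≤ C * Real.exp ((pinnedChain ω₂ lam β γ).hamiltonian N y / (8 * T)))
    (hwb : ∀ y, |w y| ≤ K * Real.exp ((pinnedChain ω₂ lam β γ).hamiltonian N y / (8 * T))) :
    Integrable (fun x => (partialP ⟨0, by omega⟩ w x) ^ 2 * (pinnedChain ω₂ lam β γ).gibbsDensity N T x) ∧
    Integrable (fun x => (partialP ⟨N - 1, by omega⟩ w x) ^ 2 * (pinnedChain ω₂ lam β γ).gibbsDensity N T x) ∧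
    γ * T * ((∫ x, (partialP ⟨0, by omega⟩ w x) ^ 2 * (pinnedChain ω₂ lam β γ).gibbsDensity N T x) +
        ∫ x, (partialP ⟨N - 1, by omega⟩ w x) ^ 2 * (pinnedChain ω₂ lam β γ).gibbsDensity N T x) =
      ∫ x, v x * w x * (pinnedChain ω₂ lam β γ).gibbsDensity N T x := by
  obtain ⟨hgw, hpw⟩ := HonestZwanzig.OrthogonalOhmLine.DirichletBound.integrable_weights (N := N) (γ := γ)
    (w := w) (g := v) hω hl hβ.le hT hw.continuous hvc hwb hvb
  have hw2 : ContDiff ℝ 2 w := hw.of_le (by norm_cast)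
  obtain ⟨hD₀, hD₁⟩ := HonestZwanzig.OrthogonalOhmLine.DirichletBound.integrable_sq_partialP_mul_gibbsDensity
    hω hl hβ.le hN2 hT hγ' hw2 hvc hLw hgw hpw
  exact ⟨hD₀, hD₁, HonestZwanzig.OrthogonalOhmLine.DirichletBound.dirichlet_identity hω hl hβ.le hN2 hT hγ' hw2 hvc
    hLw hgw hpw⟩

end Pinned

end Pencil

/-! ## Registered helper stub -/

open Pencil in
/-- **Registered sub-goal `stub_pencilOfGreenKubo_poisson`** of the crux (this file's ticket): smooth Poisson solutions for
centred nice sources at `0 ≤ lam` (= `Pencil.exists_poisson_solution`). [cite: CuneoEckmannHairerReyBellet2018, Thm 2.13]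
[cite: Hormander1967, Thm 1.1] -/
theorem stub_pencilOfGreenKubo_poisson :
    ∀ (N : ℕ) (ω₂ lam β γ : ℝ), 0 < ω₂ → 0 ≤ lam → 0 < β → 0 < γ → ∀ (T : ℝ), 0 < T → 0 < N → ∀ (v : Literature.MathematicalPhysics.KineticTheory.HeatConduction.PhaseSpace N → ℝ), ContDiff ℝ ((⊤ : ℕ∞) : WithTop ℕ∞) v → ∀ (C : ℝ), 0 ≤ C → (∀ y, |v y| ≤ C * Real.exp ((Literature.MathematicalPhysics.KineticTheory.HeatConduction.pinnedChain ω₂ lam β γ).hamiltonian N y / (8 * T))) → ∫ x, v x * (Literature.MathematicalPhysics.KineticTheory.HeatConduction.pinnedChain ω₂ lam β γ).gibbsDensity N T x = 0 → ∃ w : Literature.MathematicalPhysics.KineticTheory.HeatConduction.PhaseSpace N → ℝ, ContDiff ℝ ((⊤ : ℕ∞) : WithTop ℕ∞) w ∧ (∀ x, (Literature.MathematicalPhysics.KineticTheory.HeatConduction.pinnedChain ω₂ lam β γ).generator N T T w x = -v x) ∧ (∃ K' : ℝ, 0 ≤ K' ∧ ∀ x, |w x| ≤ K' * Real.exp ((Literature.MathematicalPhysics.KineticTheory.HeatConduction.pinnedChain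 ω₂ lam β γ).hamiltonian N x / (8 * T))) ∧ (∃ M c : ℝ, 0 ≤ M ∧ 0 < c ∧ ∀ (t : NNReal) (z : Literature.MathematicalPhysics.KineticTheory.HeatConduction.PhaseSpace N), |∫ y, v y ∂((Literature.MathematicalPhysics.KineticTheory.HeatConduction.pinnedChain ω₂ lam β γ).transitionKernel N T T t z)| ≤ M * Real.exp ((Literature.MathematicalPhysics.KineticTheory.HeatConduction.pinnedChain ω₂ lam β γ).hamiltonian N z / (8 * T)) * Real.exp (-c * t)) ∧ Filter.EventuallyEq (MeasureTheory.ae MeasureTheory.volume) (fun x => ∫ t in Set.Ioi (0 : ℝ), ∫ y, v y ∂((Literature.MathematicalPhysics.KineticTheory.HeatConduction.pinnedChain ω₂ lam β γ).transitionKernel N T T t.toNNReal x)) w :=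
  fun _ _ _ _ _ hω hl hβ hγ _ hT hN _ hv _ hC hvb hv0 => exists_poisson_solution hω hβ hγ hT hN hl hv hC hvb hv0

end Summit.AtomisticToContinuum.FouriersLaw.Theorems.ContactStieltjesMeasure.CayleyPencil

end
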